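import Summits.Ventures.PercRepro.Night2FatYGood
import Summits.Ventures.PercRepro.Night2FatXGenericTwelveA

/-!
# night-2: the unloaded targets of the fat case under the DISTANCE-1 HYPOTHESIS

The five «unloaded-target» lemmas of gen 33 — a target missing at most two points of `G`, the targets through a free
point, the targets of a collinear `W ∖ {x}`, the count of the loaded targets through a point of a basis line, the
targets through a point of a basis line and a point off it — under the hypothesis `hD1` of the basis pair `(B, z)`:
«every loaded target above `Q` carries a rank-`2` line `R ⊆ (T ∖ K) ∖ {w₀, x}` with `|R| ≥ 3`, `|R| + 4 = |T ∖ K|` and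
`rk (G ∖ T) ≥ 3`» (the distance-1 branch of `loaded_fat_target_dichotomy`), in place of generic off-points.  `hD1`
holds for every pair when every lossy big pair of `G` has a good point (`loaded_fat_target_dist_one_of_good`), and in
the two-planes regime for the pairs without a basis point on the spine.  Each proof is the gen-33 proof with the
dichotomy replaced by `hD1`.  Paper `proofs/NIGHT-2-g34.md` §1.
-/

namespace PercRepro.Shadow

open PercRepro.ThmH PercRepro.PerFlat

variable {α : Type*} [DecidableEq α] {M : Matroid α} [M.Finite] {G : Finset α}

/-- **Under the distance-1 hypothesis a target missing at most two points of `G` is unloaded**: a distance-1 load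
needs `rk (G ∖ T) ≥ 3`. -/
theorem dload_eq_zero_of_card_sdiff_le_two_of_D1 {B : Finset α} {z : α} {w₀ x : α}
    (hD1 : ∀ T ∈ tgtSets M 5 G B z, x ∈ T → dload M 5 G (bigP M G) (dshGT2 M 5 G) T ≠ 0 →
      ∃ R ⊆ (T \ coloops M G) \ {w₀, x}, rkN M R = 2 ∧ 3 ≤ R.card ∧ R.card + 4 = (T \ coloops M G).card ∧
        3 ≤ rkN M (G \ T))
    {T : Finset α} (hT : T ∈ tgtSets M 5 G B z) (hxT : x ∈ T) (h2 : (G \ T).card ≤ 2) :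
    dload M 5 G (bigP M G) (dshGT2 M 5 G) T = 0 := by
  by_contra hload
  obtain ⟨-, -, -, -, -, hrk⟩ := hD1 T hT hxT hload
  have := rkN_le_card (M := M) (G \ T)
  omega

/-- **A target through `x` and a free point `y` is unloaded when the off-points are generic.** -/
theorem dload_eq_zero_of_free_of_D1 (hG : G ∈ flatsQ M (5 + 1)) (hd : (gr M \ G).card = 2)
    (hk : kColoops M G = 1) (hs : ∀ e ∈ gr M, ∀ f ∈ gr M, e ≠ f → rkN M {e, f} = 2)
   
    {w₀ x : α} {B : Finset α} (hB : B ∈ thinMembers M 5 G) (hnP : ¬ bigP M G B) {z : α} (hz : z ∈ G \ clF M B)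
    (hD1 : ∀ T ∈ tgtSets M 5 G B z, x ∈ T → dload M 5 G (bigP M G) (dshGT2 M 5 G) T ≠ 0 →
      ∃ R ⊆ (T \ coloops M G) \ {w₀, x}, rkN M R = 2 ∧ 3 ≤ R.card ∧ R.card + 4 = (T \ coloops M G).card ∧
        3 ≤ rkN M (G \ T)) (hx : x ∉ insert z B) {y : α} (hy : y ∈ G \ insert z B) (hxy : x ≠ y)
    (hfree : ∀ a ∈ (insert z B \ coloops M G).erase w₀, ∀ b ∈ (insert z B \ coloops M G).erase w₀, a ≠ b →
      rkN M {a, b, y} = 3) {T : Finset α} (hT : T ∈ tgtSets M 5 G B z) (hxT : x ∈ T) (hyT : y ∈ T) :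
    dload M 5 G (bigP M G) (dshGT2 M 5 G) T = 0 := by
  by_contra hload
  have hTG : T ⊆ G := subset_G_of_mem_shadowAt (mem_tgtSets.1 hT).1
  obtain ⟨R, hR, hR2, hR3, hRc, -⟩ := hD1 T hT hxT hload
  obtain ⟨a, ha, b, hb, hab, hrk⟩ :=
    exists_basis_line_of_dist_one_fat hG hd hk hs hB hnP hz hT hxT hx hR hR2 hRc
  have hyY : y ∈ (T \ insert z B).erase x :=
    Finset.mem_erase.2 ⟨fun h' => hxy h'.symm, Finset.mem_sdiff.2 ⟨hyT, (Finset.mem_sdiff.1 hy).2⟩⟩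
  have hsub : ({a, b, y} : Finset α) ⊆ insert a (insert b ((T \ insert z B).erase x)) := by
    intro e he
    rw [Finset.mem_insert, Finset.mem_insert, Finset.mem_singleton] at he
    rw [Finset.mem_insert, Finset.mem_insert]
    rcases he with rfl | rfl | rfl
    · exact Or.inl rfl
    · exact Or.inr (Or.inl rfl)
    · exact Or.inr (Or.inr hyY)
  have h1 := rkN_mono (M := M) hsub
  rw [hrk, hfree a ha b hb hab] at h1
  omega

/-- **With `W ∖ {x}` of rank `≤ 2` and generic off-points nothing above `Q ∪ {x}` is loaded.** -/
theorem dload_eq_zero_of_collinear_of_D1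
   
   
    {w₀ x : α} {B : Finset α} {z : α}
    (hD1 : ∀ T ∈ tgtSets M 5 G B z, x ∈ T → dload M 5 G (bigP M G) (dshGT2 M 5 G) T ≠ 0 →
      ∃ R ⊆ (T \ coloops M G) \ {w₀, x}, rkN M R = 2 ∧ 3 ≤ R.card ∧ R.card + 4 = (T \ coloops M G).card ∧
        3 ≤ rkN M (G \ T)) (hcol : rkN M ((G \ insert z B).erase x) ≤ 2) {T : Finset α}
    (hT : T ∈ tgtSets M 5 G B z) (hxT : x ∈ T) :
    dload M 5 G (bigP M G) (dshGT2 M 5 G) T = 0 := by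
  by_contra hload
  have hTG : T ⊆ G := subset_G_of_mem_shadowAt (mem_tgtSets.1 hT).1
  have hQT : insert z B ⊆ T := (mem_tgtSets.1 hT).2.1
  obtain ⟨R, hR, hR2, hR3, -, hrk⟩ := hD1 T hT hxT hload
  have hsub : G \ T ⊆ (G \ insert z B).erase x := by
    intro e he
    rw [Finset.mem_sdiff] at he
    exact Finset.mem_erase.2 ⟨fun h' => he.2 (h' ▸ hxT), Finset.mem_sdiff.2 ⟨he.1, fun h' => he.2 (hQT h')⟩⟩
  have := rkN_mono (M := M) hsub
  omega

open scoped Classical in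
/-- **The loaded targets through `x` and a point `y₁` of the basis line `ℓ_ab` at level `j` number at most
`C(t₁ − 1, j − 2)`**, `t₁` the number of points of `W ∖ {x}` on `ℓ_ab`, when the off-points are generic: every
such load is at distance one with its `Y ⊆ ℓ_ab`. -/
theorem card_loaded_targets_through_le_of_D1 (hG : G ∈ flatsQ M (5 + 1)) (hd : (gr M \ G).card = 2)
    (hk : kColoops M G = 1) (hs : ∀ e ∈ gr M, ∀ f ∈ gr M, e ≠ f → rkN M {e, f} = 2)
    (hl : ∀ e ∈ gr M, M.Indep {e}) {w₀ x : α}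
    {B : Finset α} (hB : B ∈ thinMembers M 5 G) (hnP : ¬ bigP M G B) {z : α} (hz : z ∈ G \ clF M B)
    (hD1 : ∀ T ∈ tgtSets M 5 G B z, x ∈ T → dload M 5 G (bigP M G) (dshGT2 M 5 G) T ≠ 0 →
      ∃ R ⊆ (T \ coloops M G) \ {w₀, x}, rkN M R = 2 ∧ 3 ≤ R.card ∧ R.card + 4 = (T \ coloops M G).card ∧
        3 ≤ rkN M (G \ T)) (hx : x ∉ insert z B) {y₁ : α} (hy₁ : y₁ ∈ (G \ insert z B).erase x) {a b : α}
    (ha : a ∈ (insert z B \ coloops M G).erase w₀) (hb : b ∈ (insert z B \ coloops M G).erase w₀) (hab : a ≠ b)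
    (hline : rkN M {a, b, y₁} ≤ 2) (j : ℕ) : ((tgtSets M 5 G B z).filter (fun T => ({x, y₁} : Finset α) ⊆ T ∧ (T \ insert z B).card = j ∧
      dload M 5 G (bigP M G) (dshGT2 M 5 G) T ≠ 0)).card ≤
      ((((G \ insert z B).erase x).filter (fun y => rkN M (insert y {a, b}) ≤ 2)).erase y₁).card.choose (j - 2) := by
  have hy₁x : y₁ ≠ x := (Finset.mem_erase.1 hy₁).1
  have hy₁G : y₁ ∈ G \ insert z B := Finset.mem_of_mem_erase hy₁
  set L := ((G \ insert z B).erase x).filter (fun y => rkN M (insert y {a, b}) ≤ 2) with hL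
  rw [← Finset.card_powersetCard]
  apply Finset.card_le_card_of_injOn (fun T => (T \ insert z B) \ {x, y₁})
  · intro T hT
    rw [Finset.mem_coe, Finset.mem_filter] at hT
    obtain ⟨hTt, hXT, hTj, hload⟩ := hT
    have hTG : T ⊆ G := subset_G_of_mem_shadowAt (mem_tgtSets.1 hTt).1
    have hxT : x ∈ T := hXT (Finset.mem_insert_self _ _)
    have hy₁T : y₁ ∈ T := hXT (Finset.mem_insert_of_mem (Finset.mem_singleton_self _))
    -- the load is at distance one and its `Y` lies on a basis line through `y₁`, which is `ℓ_ab`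
    obtain ⟨R, hR, hR2, hR3, hRc, -⟩ := hD1 T hTt hxT hload
    obtain ⟨a', ha', b', hb', hab', hrk⟩ :=
      exists_basis_line_of_dist_one_fat hG hd hk hs hB hnP hz hTt hxT hx hR hR2 hRc
    have hy₁Y : y₁ ∈ (T \ insert z B).erase x :=
      Finset.mem_erase.2 ⟨hy₁x, Finset.mem_sdiff.2 ⟨hy₁T, (Finset.mem_sdiff.1 hy₁G).2⟩⟩
    have hsub₁ : ({a', b', y₁} : Finset α) ⊆ insert a' (insert b' ((T \ insert z B).erase x)) := by
      intro e he
      rw [Finset.mem_insert, Finset.mem_insert, Finset.mem_singleton] at he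
      rw [Finset.mem_insert, Finset.mem_insert]
      rcases he with rfl | rfl | rfl
      · exact Or.inl rfl
      · exact Or.inr (Or.inl rfl)
      · exact Or.inr (Or.inr hy₁Y)
    have hrk₁ : rkN M {a', b', y₁} ≤ 2 := by
      have := rkN_mono (M := M) hsub₁
      rw [hrk] at this
      exact this
    have hsame : ({a, b} : Finset α) = {a', b'} := by
      by_contra hne
      exact not_on_two_basis_lines hG hd hk hs hl hB hnP hz (Finset.mem_of_mem_erase ha)
        (Finset.mem_of_mem_erase hb) (Finset.mem_of_mem_erase ha') (Finset.mem_of_mem_erase hb') hab hab' hne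
        hy₁G hline hrk₁
    rw [Finset.mem_coe, Finset.mem_powersetCard]
    constructor
    · intro e he
      rw [Finset.mem_sdiff, Finset.mem_insert, Finset.mem_singleton, not_or] at he
      obtain ⟨heTQ, hex, hey₁⟩ := he
      refine Finset.mem_erase.2 ⟨hey₁, ?_⟩
      rw [hL, Finset.mem_filter]
      refine ⟨Finset.mem_erase.2 ⟨hex, Finset.sdiff_subset_sdiff hTG (Finset.Subset.refl _) heTQ⟩, ?_⟩
      have hsub₂ : insert e {a, b} ⊆ insert a' (insert b' ((T \ insert z B).erase x)) := by
        intro u hu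
        rw [Finset.mem_insert] at hu
        rcases hu with rfl | hu
        · exact Finset.mem_insert_of_mem (Finset.mem_insert_of_mem (Finset.mem_erase.2 ⟨hex, heTQ⟩))
        · rw [hsame, Finset.mem_insert, Finset.mem_singleton] at hu
          rw [Finset.mem_insert, Finset.mem_insert]
          rcases hu with rfl | rfl
          · exact Or.inl rfl
          · exact Or.inr (Or.inl rfl)
      have := rkN_mono (M := M) hsub₂
      rw [hrk] at this
      exact this
    · have hXsub : ({x, y₁} : Finset α) ⊆ T \ insert z B := by
        intro e he
        rw [Finset.mem_insert, Finset.mem_singleton] at he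
        rcases he with rfl | rfl
        · exact Finset.mem_sdiff.2 ⟨hxT, hx⟩
        · exact Finset.mem_sdiff.2 ⟨hy₁T, (Finset.mem_sdiff.1 hy₁G).2⟩
      rw [Finset.card_sdiff_of_subset hXsub, hTj, Finset.card_pair hy₁x.symm]
  · intro T₁ hT₁ T₂ hT₂ heq
    rw [Finset.mem_coe, Finset.mem_filter] at hT₁ hT₂
    have key : ∀ T ∈ tgtSets M 5 G B z, ({x, y₁} : Finset α) ⊆ T →
        T = insert z B ∪ ({x, y₁} ∪ ((T \ insert z B) \ {x, y₁})) := by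
      intro T hT hXT
      have hQT : insert z B ⊆ T := (mem_tgtSets.1 hT).2.1
      ext e
      simp only [Finset.mem_union, Finset.mem_sdiff]
      constructor
      · intro heT
        by_cases heQ : e ∈ insert z B
        · exact Or.inl heQ
        · by_cases heX : e ∈ ({x, y₁} : Finset α)
          · exact Or.inr (Or.inl heX)
          · exact Or.inr (Or.inr ⟨⟨heT, heQ⟩, heX⟩)
      · rintro (heQ | heX | ⟨⟨heT, -⟩, -⟩)
        · exact hQT heQ
        · exact hXT heX
        · exact heT
    rw [key T₁ hT₁.1 hT₁.2.1, key T₂ hT₂.1 hT₂.2.1]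
    simp only at heq
    rw [heq]

/-- **A target through `x` and two points on different basis lines (or one off every basis line) is unloaded**
with generic off-points: a distance-1 load has its `Y` inside one basis line. -/
theorem dload_eq_zero_of_two_lines_of_D1 (hG : G ∈ flatsQ M (5 + 1)) (hd : (gr M \ G).card = 2)
    (hk : kColoops M G = 1) (hs : ∀ e ∈ gr M, ∀ f ∈ gr M, e ≠ f → rkN M {e, f} = 2)
    (hl : ∀ e ∈ gr M, M.Indep {e}) {w₀ x : α}
    {B : Finset α} (hB : B ∈ thinMembers M 5 G) (hnP : ¬ bigP M G B) {z : α} (hz : z ∈ G \ clF M B)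
    (hD1 : ∀ T ∈ tgtSets M 5 G B z, x ∈ T → dload M 5 G (bigP M G) (dshGT2 M 5 G) T ≠ 0 →
      ∃ R ⊆ (T \ coloops M G) \ {w₀, x}, rkN M R = 2 ∧ 3 ≤ R.card ∧ R.card + 4 = (T \ coloops M G).card ∧
        3 ≤ rkN M (G \ T)) (hx : x ∉ insert z B) {y₁ y₂ : α} (hy₁ : y₁ ∈ (G \ insert z B).erase x) (hy₂ : y₂ ∈ (G \ insert z B).erase x)
    {a b : α} (ha : a ∈ (insert z B \ coloops M G).erase w₀) (hb : b ∈ (insert z B \ coloops M G).erase w₀)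
    (hab : a ≠ b) (hline : rkN M {a, b, y₁} ≤ 2) (hoff : ¬ rkN M (insert y₂ {a, b}) ≤ 2)
    {T : Finset α} (hT : T ∈ tgtSets M 5 G B z) (hxT : x ∈ T) (hy₁T : y₁ ∈ T) (hy₂T : y₂ ∈ T) :
    dload M 5 G (bigP M G) (dshGT2 M 5 G) T = 0 := by
  by_contra hload
  have hTG : T ⊆ G := subset_G_of_mem_shadowAt (mem_tgtSets.1 hT).1
  obtain ⟨R, hR, hR2, hR3, hRc, -⟩ := hD1 T hT hxT hload
  obtain ⟨a', ha', b', hb', hab', hrk⟩ :=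
    exists_basis_line_of_dist_one_fat hG hd hk hs hB hnP hz hT hxT hx hR hR2 hRc
  have hy₁Y : y₁ ∈ (T \ insert z B).erase x :=
    Finset.mem_erase.2 ⟨(Finset.mem_erase.1 hy₁).1,
      Finset.mem_sdiff.2 ⟨hy₁T, (Finset.mem_sdiff.1 (Finset.mem_of_mem_erase hy₁)).2⟩⟩
  have hy₂Y : y₂ ∈ (T \ insert z B).erase x :=
    Finset.mem_erase.2 ⟨(Finset.mem_erase.1 hy₂).1,
      Finset.mem_sdiff.2 ⟨hy₂T, (Finset.mem_sdiff.1 (Finset.mem_of_mem_erase hy₂)).2⟩⟩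
  have hsub₁ : ({a', b', y₁} : Finset α) ⊆ insert a' (insert b' ((T \ insert z B).erase x)) := by
    intro e he
    rw [Finset.mem_insert, Finset.mem_insert, Finset.mem_singleton] at he
    rw [Finset.mem_insert, Finset.mem_insert]
    rcases he with rfl | rfl | rfl
    · exact Or.inl rfl
    · exact Or.inr (Or.inl rfl)
    · exact Or.inr (Or.inr hy₁Y)
  have hrk₁ : rkN M {a', b', y₁} ≤ 2 := by
    have := rkN_mono (M := M) hsub₁
    rw [hrk] at this
    exact this
  have hsame : ({a, b} : Finset α) = {a', b'} := by
    by_contra hne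
    exact not_on_two_basis_lines hG hd hk hs hl hB hnP hz (Finset.mem_of_mem_erase ha)
      (Finset.mem_of_mem_erase hb) (Finset.mem_of_mem_erase ha') (Finset.mem_of_mem_erase hb') hab hab' hne
      (Finset.mem_of_mem_erase hy₁) hline hrk₁
  apply hoff
  have hsub₂ : insert y₂ {a, b} ⊆ insert a' (insert b' ((T \ insert z B).erase x)) := by
    intro u hu
    rw [Finset.mem_insert] at hu
    rcases hu with rfl | hu
    · exact Finset.mem_insert_of_mem (Finset.mem_insert_of_mem hy₂Y)
    · rw [hsame, Finset.mem_insert, Finset.mem_singleton] at hu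
      rw [Finset.mem_insert, Finset.mem_insert]
      rcases hu with rfl | rfl
      · exact Or.inl rfl
      · exact Or.inr (Or.inl rfl)
  have := rkN_mono (M := M) hsub₂
  rw [hrk] at this
  exact this

end PercRepro.Shadow
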